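import Summits.ResolutionOfSingularities.ResolutionOfSingularities.Theorems.FrobeniusClosingSteerNonRationalStepKeyDerivation
import HarnessLib

/-!
# Crux `Steer` (stmt-ResolutionOfSingularities-16345), chain W4.1, hGW3 / I″ KERNEL (K-I2) FILE F: THE VERTICAL READING — a derivation of the
# chart `B` into `Ŝ₁` which is vertical modulo `X₀` descends through `Θ : B ↠ κ₀[T,U]` and sends the clean polynomial into `ε(𝔭)`
# (Theses-free, definition-free)

OURS (campaign `res-hironaka`, rung L ★L-G4, slot W4.1; seat res-D-pv-040 g8, custody res-plan-2 DEAL #69 MENU (M-f) / res-L0-w41-idea-3 20:07:47Z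
«STARTABLE NOW»; author of the architecture res-L0-w41-idea-3 g12: `L/res-L0-w41-idea-3/lemmaI2k/K-I2-BLUEPRINT.md` §1 row F / §2 F, signature file
`K-I2_signatures.lean` e62c805738af0a97 §FileF — the statement of `vertical_apply_mem` below is that signature VERBATIM; input FILE B
`…NonRationalStepKeyDerivation` (`LemmaI2.derivation_apply_mem_map_of_clean`, res-L0-w41-idea-3); consumer FILE H `…NonRationalStepNotIsolated`;
`--supports stmt-ResolutionOfSingularities-16345 --as helper`). Replaces the role of no printed item and is NOT a statement of the manuscript under
review [claim: Hironaka2017, status: under-review]; AI-produced plumbing, weaker than expert review; nothing here is progress on resolution of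
singularities in characteristic `p` by itself.

* `apply_eq_of_map_eq` — a derivation `Δ : B → Ah` along `ψ` with `π (Δ X_b) = 0` is, after `π`, constant on the fibres of a ring surjection
  `Θ : B ↠ M` with kernel `(X_b)` compatible with `ε ∘ Θ = π ∘ ψ` (`b − b′ = c·X_b ⇒ π Δ(b) − π Δ(b′) = π(ψ c)·π(Δ X_b) + ε(Θ X_b)·π(Δ c) = 0`).
* **`vertical_apply_mem`** (FILE F, signature VERBATIM): the descended `δ m := π (Δ b)` (`Θ b = m`) is additive with the Leibniz rule along `ε`,
  and FILE B's (KEY′) `derivation_apply_mem_map_of_clean` gives `δ P = π (Δ F_b) ∈ ε(𝔭)·N`.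

[cite: Matsumura1987, §26 and Thm. 30.5 (derivations, extension along ring maps)] bears_on: LADDER-RESOLUTION L ★L-G4 W4.1 (crux `Steer`, hGW3 at
`e ≥ 3` = WORK-MODULO {I″}; I″ kernel file F of eight).
-/

noncomputable section

set_option linter.dupNamespace false

namespace Summit.ResolutionOfSingularities.ResolutionOfSingularities.Theorems.SwitchingDichotomy.LemmaI2

open Module

variable {K : Type} [Field K] [CharP K 2]

/-- **Descent of a derivation along a surjection with principal kernel.** If `Δ : B → Ah` is a derivation along `ψ`, `Θ : B ↠ M` has
kernel `(X_b)`, `ε ∘ Θ = π ∘ ψ`, and `π (Δ X_b) = 0`, then `π ∘ Δ` is constant on the fibres of `Θ`. OURS plumbing. (folklore) -/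
theorem apply_eq_of_map_eq {B Ah N M : Type} [CommRing B] [CommRing Ah] [CommRing N] [CommRing M]
    (Θ : B →+* M) {Xb : B} (hker : RingHom.ker Θ = Ideal.span {Xb})
    (ψ : B →+* Ah) (π : Ah →+* N) (ε : M →+* N) (hε : ∀ b, ε (Θ b) = π (ψ b))
    (Δ : B → Ah) (hadd : ∀ x y, Δ (x + y) = Δ x + Δ y) (hmul : ∀ x y, Δ (x * y) = ψ x * Δ y + ψ y * Δ x)
    (hΔX : π (Δ Xb) = 0) {b b' : B} (h : Θ b = Θ b') : π (Δ b) = π (Δ b') := by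
  have hsub : b - b' ∈ RingHom.ker Θ := by rw [RingHom.mem_ker, map_sub, h, sub_self]
  rw [hker, Ideal.mem_span_singleton'] at hsub
  obtain ⟨c, hc⟩ := hsub
  have hb : b = c * Xb + b' := by rw [hc, sub_add_cancel]
  have hXb0 : Θ Xb = 0 := by
    have : Xb ∈ RingHom.ker Θ := by rw [hker]; exact Ideal.mem_span_singleton_self Xb
    exact this
  rw [hb, hadd, hmul, map_add, map_add, map_mul, map_mul, hΔX, mul_zero, zero_add, ← hε, hXb0, map_zero, zero_mul, zero_add]

/-- (F) **VERTICAL READING** — signature VERBATIM from res-L0-w41-idea-3's `K-I2_signatures.lean` e62c805738af0a97 §FileF. A derivation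
`Δ : B → Ah` along `ψ` which is VERTICAL modulo `X₀` (`π (Δ X_b) = 0`) descends through the chart surjection `Θ : B ↠ M = K[T,U]` (kernel
`(X_b)`) to a derivation `δ : M → N` along `ε` (`ε ∘ Θ = π ∘ ψ`), and FILE B's (KEY′) `derivation_apply_mem_map_of_clean` puts `δ P = π (Δ F_b)`
into `ε(𝔭)·N`. OURS. [cite: Matsumura1987, §26, Thm. 30.5] (folklore) -/
theorem vertical_apply_mem {B Ah N : Type} [CommRing B] [CommRing Ah] [CommRing N]
    (Θ : B →+* MvPolynomial (Fin 2) K) (hΘ : Function.Surjective Θ) {Xb : B} (hker : RingHom.ker Θ = Ideal.span {Xb})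
    (ψ : B →+* Ah) (π : Ah →+* N) (ε : MvPolynomial (Fin 2) K →+* N) (hε : ∀ b, ε (Θ b) = π (ψ b))
    (𝔫 : Ideal (MvPolynomial (Fin 2) K)) [𝔫.IsMaximal] (𝔭 : Ideal (MvPolynomial (Fin 2) K)) [𝔭.IsPrime] (h𝔭𝔫 : 𝔭 ≤ 𝔫)
    {P s a h : MvPolynomial (Fin 2) K} {d δ' : ℕ}
    (hP : P.totalDegree ≤ d) (hs : s ∉ 𝔫) (hclean : s ^ 2 * P - a ^ 2 ∈ 𝔫 ^ d) (hh : h ∈ 𝔭) (hh0 : h ≠ 0)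
    (hdeg : h.totalDegree ≤ δ') (hineq : δ' * d < (d - 1) * finrank K (MvPolynomial (Fin 2) K ⧸ 𝔫))
    {Fb : B} (hFb : Θ Fb = P)
    (Δ : B → Ah) (hadd : ∀ x y, Δ (x + y) = Δ x + Δ y) (hmul : ∀ x y, Δ (x * y) = ψ x * Δ y + ψ y * Δ x)
    (hΔX : π (Δ Xb) = 0) :
    π (Δ Fb) ∈ Ideal.map ε 𝔭 := by
  classical
  -- the descended derivation `δ m := π (Δ b)` for any `b` with `Θ b = m`
  let δ : MvPolynomial (Fin 2) K → N := fun m => π (Δ (Classical.choose (hΘ m)))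
  have hδ : ∀ b, δ (Θ b) = π (Δ b) := fun b =>
    apply_eq_of_map_eq Θ hker ψ π ε hε Δ hadd hmul hΔX (Classical.choose_spec (hΘ (Θ b)))
  have hδadd : ∀ x y, δ (x + y) = δ x + δ y := by
    intro x y
    obtain ⟨b, rfl⟩ := hΘ x; obtain ⟨b', rfl⟩ := hΘ y
    rw [← map_add, hδ, hδ, hδ, hadd, map_add]
  have hδmul : ∀ x y, δ (x * y) = ε x * δ y + ε y * δ x := by
    intro x y
    obtain ⟨b, rfl⟩ := hΘ x; obtain ⟨b', rfl⟩ := hΘ y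
    rw [← map_mul, hδ, hδ, hδ, hmul, map_add, map_mul, map_mul, hε, hε]
  have key := derivation_apply_mem_map_of_clean 𝔫 𝔭 h𝔭𝔫 hP hs hclean hh hh0 hdeg hineq ε δ hδadd hδmul
  rwa [← hFb, hδ] at key

end Summit.ResolutionOfSingularities.ResolutionOfSingularities.Theorems.SwitchingDichotomy.LemmaI2

end
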